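import Summits.QuantumFields.YangMills.Theorems.BalabanUVNodesN21ShellSplitOfRecord13CoPHLaw
import Literature.MathematicalPhysics.QuantumFieldTheory.Balaban1983to89.B16Eq150VariableFields

/-!
# N21 (NE7c) · THE SHELL SPLIT OF RECORD, THE BLOCK DISINTEGRATION: (M1) on the `a`-truncated dressed law ⟸ the SAME (M1) on its BLOCK FIBRE LAWS at every
# exterior field — product Haar split along any finite bond set `b` (Tonelli over `MeasureTheory.lmarginal`), so that N21 at the record is asked of laws on the finite
# product `(SU N)^b` (the home of the dilation ∕ hazard devices, parts 7–39), one exterior configuration at a time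

R134 seat `pub-ymgap-dag-n21-d` (g9), node N21 = NE7c (NOT PRINTED, NOT proved), strategy s2; lane K3⁷ `SpineGivenEndpointR13SepCoPH` (stmt-QuantumFields-20544,
`--supports … --as helper`; COUNT-NEUTRAL).  Imports `…N21ShellSplitOfRecord13CoPHLaw` (hence the definition lane v1.1: `cubeDensityOfDatum₉`, `blockFibreLawOfDatum₉`,
`blockReading`) and `Literature…B16Eq150VariableFields` (`isMinimizer_of_agreeOn`, the (2.10)-locality of the (2.12) problem, cited by name).  Part 9 (`…N21GibbsBlockSupHazard.measure_coordSlice_le_of_fibrewise`) is the ONE-real-coordinate Lebesgue model of §1; here the coordinates are a finite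
SET of `SU(N)`-valued bonds under product Haar, via Mathlib's `lintegral_le_of_lmarginal_le`.

WHAT THIS FILE PROVES (theorems only; 0 `def`, 0 `sorry`).
* §1 [folklore, generic] ★ `withDensity_pi_apply_le_of_lmarginal`: on a finite product `Measure.pi μ` (σ-finite factors) with a measurable density
  `g`, if along a finite coordinate block `b` the block integrals satisfy `∫⋯∫⁻_b 𝟙_S g ≤ c · ∫⋯∫⁻_b 𝟙_T g` AT EVERY base point, then
  `(pi μ).withDensity g S ≤ c · (pi μ).withDensity g T`.
* §2 at NODE 00's generality (`ϑ D g₀ os p g k`; displayed rows (H-U), (H-ζ), `D.AvgMeasurable`): `measurable_cubeDensityOfDatum₉` · ★ `cubeLawOfDatum₉_eq_withDensity`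
  (the truncated law IS product Haar with the summed density) · `blockFibreLawOfDatum₉_apply` (the fibre law on a measurable block event = the block integral of the
  pulled-back indicator × density) · ★★★ `slotAntiConcentration_cubeLaw_of_blockFibres`: for ANY finite bond set `b`, ANY measurable statistic `u`, thresholds `θ, ρ`
  and constant `D`: (M1) `SlotAntiConcentration (blockFibreLawOfDatum₉ … t a b x) (blockReading u b x) θ ρ D` AT EVERY exterior field `x`
  ⇒ `SlotAntiConcentration (cubeLawOfDatum₉ … t a) u θ ρ D` — the hypothesis of `…Law.cubeAC_of_slotAntiConcentration`.

* §3 LOCALITY: ★ `cubeChiAt_congr_of_agree_inputs` (the cube indicator reads `V` only on `liftIter k (inputs 𝐁_k(a^{∼4}))` — bgOfRecord is a function of the (2.12)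
  predicate, which reads its datum on the determining set only ([III] (2.12)); r11's `ukBox_congr` BY NAME) · ★★ `cubeChiAt_updateFinset_eq` (on a block `b` containing those
  inputs the fibre indicator does not see the exterior field).

UPSHOT.  N21 AT THE RECORD = per (run, K, t, top cube a) and per EXTERIOR FIELD x off a bond block b: (M1) for a law on `(SU N)^b` with an explicit density (the
(2.18) dressed integrand of record with the exterior frozen) and the cube statistic read on the block — with `Σ_K D_K ρ_K < ∞`.  The block `b` is free (the natural
one: the bonds the (2.16) local background of `a` reads); locality of `u` is not even needed for the implication.  NOT PRINTED; NOT proved here.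

HONEST FRAMING.  [folklore] product-measure bookkeeping (`lmarginal`, `withDensity`); NO estimate; nothing of Bałaban's asserted; K0⁷ open; NE7c NOT proved; N21 NOT
discharged; K3⁷ NOT claimed; counts UNMOVED (typed 28∕28 · discharged 5∕27); never a count claim.  No `instance`, no `notation`, no `def`.  One finite four-torus
programme at fixed `ε` — NOT ℝ⁴, NOT OS, NOT a mass gap, NOT the Clay problem.
-/

noncomputable section

open scoped BigOperators ENNReal
open Finset MeasureTheory

namespace Summit.QuantumFields.YangMills.Theorems.N21ShellSplitOfRecord13CoPH

open Literature.MathematicalPhysics.QuantumFieldTheory.Balaban1983to89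
open Literature.MathematicalPhysics.QuantumFieldTheory.Balaban1983to89.T4Continuum
open Literature.MathematicalPhysics.QuantumFieldTheory.Balaban1983to89.Node00
open T4ShellMeasure (SlotAntiConcentration shell_eq_preimage)
open Summit.QuantumFields.YangMills.BalabanUVNodes.N19MGFRoadLiveSelectorTower (measurable_dressedSlotsOfDatum₉)

/-! ## §1 Generic: a block-wise relative bound integrates to a relative bound under the product measure -/

section Generic

variable {δ : Type*} [DecidableEq δ] {X : δ → Type*} [∀ i, MeasurableSpace (X i)] (μ : ∀ i, Measure (X i))

/-- ★ **A BLOCK-WISE RELATIVE BOUND INTEGRATES**: on `Measure.pi μ` with a measurable density `g`, if along the coordinate block `b` the block integrals satisfy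
`∫⋯∫⁻_b 𝟙_S·g ≤ c · ∫⋯∫⁻_b 𝟙_T·g` at EVERY base point, then `(pi μ).withDensity g S ≤ c · (pi μ).withDensity g T` (Tonelli: Mathlib `lintegral_le_of_lmarginal_le`).
[folklore] -/
theorem withDensity_pi_apply_le_of_lmarginal [Fintype δ] [∀ i, SigmaFinite (μ i)] {g : (∀ i, X i) → ℝ≥0∞} (hg : Measurable g) (b : Finset δ) {S T : Set (∀ i, X i)}
    (hS : MeasurableSet S) (hT : MeasurableSet T) (c : ℝ≥0∞)
    (hfib : ∀ x, (∫⋯∫⁻_b, S.indicator g ∂μ) x ≤ c * (∫⋯∫⁻_b, T.indicator g ∂μ) x) :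
    (Measure.pi μ).withDensity g S ≤ c * (Measure.pi μ).withDensity g T := by
  rw [withDensity_apply _ hS, withDensity_apply _ hT, ← lintegral_indicator hS, ← lintegral_indicator hT,
    ← lintegral_const_mul c (hg.indicator hT)]
  refine lintegral_le_of_lmarginal_le b (hg.indicator hS) ((hg.indicator hT).const_mul c) fun x => ?_
  -- constants come out of the block integral (`lintegral_const_mul`; cf. `RandomRefit.lmarginal_const_mul` in the QCD tree, not imported)
  rw [show (∫⋯∫⁻_b, (fun y => c * T.indicator g y) ∂μ) x = c * (∫⋯∫⁻_b, T.indicator g ∂μ) x from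
    lintegral_const_mul c ((hg.indicator hT).comp measurable_updateFinset)]
  exact hfib x

end Generic

/-! ## §2 At NODE 00's objects of record: the truncated law is product Haar with the summed density; its block fibre laws; the disintegration -/

section Fibre

variable (F : T4Family) (N : ℕ) [NeZero N] (ϑ : Stage9Params F N) (D : FiniteEpsData F (SU N)) (g₀ : ℕ → ℝ) (os : List (ULoop F))
  (p : B12.RunParams) (g : ℕ → ℝ) (k : ℕ)

/-- the summed density is measurable ((H-U), (H-ζ) and `D.AvgMeasurable`: dag-n19-c's `measurable_dressedSlotsOfDatum₉`, K0c's measurability rows BY NAME). [bookkeeping] -/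
theorem measurable_cubeDensityOfDatum₉ (hU : LocalBgMeasurable F N ϑ.ν) (hζm : ZetaMeasurable F N ϑ.ζ) (hD : D.AvgMeasurable) (t : ℝ)
    (a : ↥(cubeIndices (F.P p.K) (cubeSide (F.P p.K).L ϑ.ν.M₂ (RkOfRecord (F.P p.K).L ϑ.ν.r (g k)) k))) :
    Measurable (cubeDensityOfDatum₉ F N ϑ D g₀ os p g k t a) := by
  have hχm : ∀ k s, Measurable (chiSeqOfRecord F N ϑ.ν ϑ.τ9.M g p.K k s) := fun k s => measurable_chiSeqOfRecord_of_localBg hU ϑ.τ9.M g p.K k s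
  have hwm : ∀ k s', Measurable (fun z : GaugeField (F.P p.K) (k + 1) (SU N) × GaugeField (F.P p.K) k (SU N) => wOfRecord₉ F N ϑ p g k s' z.2 z.1) :=
    fun k s' => measurable_wOfRecord_of_localBg hU ϑ.τ9.M ϑ.A₁ hζm p g k s'
  have hsl := measurable_dressedSlotsOfDatum₉ F N ϑ D g₀ os p g hD hwm hχm t k
  unfold cubeDensityOfDatum₉
  refine Finset.measurable_sum _ fun s _ => ?_
  split_ifs
  · exact ((hχm k s).mul (hsl s)).ennreal_ofReal
  · exact measurable_const

/-- ★ **THE TRUNCATED LAW IS PRODUCT HAAR WITH THE SUMMED DENSITY**: `cubeLawOfDatum₉ … t a = (fieldMeasure …).withDensity (cubeDensityOfDatum₉ … t a)`. [bookkeeping] -/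
theorem cubeLawOfDatum₉_eq_withDensity (hU : LocalBgMeasurable F N ϑ.ν) (hζm : ZetaMeasurable F N ϑ.ζ) (hD : D.AvgMeasurable) (t : ℝ)
    (a : ↥(cubeIndices (F.P p.K) (cubeSide (F.P p.K).L ϑ.ν.M₂ (RkOfRecord (F.P p.K).L ϑ.ν.r (g k)) k))) :
    cubeLawOfDatum₉ F N ϑ D g₀ os p g k t a = (fieldMeasure (F.P p.K) k (SU N)).withDensity (cubeDensityOfDatum₉ F N ϑ D g₀ os p g k t a) := by
  have hχm : ∀ k s, Measurable (chiSeqOfRecord F N ϑ.ν ϑ.τ9.M g p.K k s) := fun k s => measurable_chiSeqOfRecord_of_localBg hU ϑ.τ9.M g p.K k s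
  have hwm : ∀ k s', Measurable (fun z : GaugeField (F.P p.K) (k + 1) (SU N) × GaugeField (F.P p.K) k (SU N) => wOfRecord₉ F N ϑ p g k s' z.2 z.1) :=
    fun k s' => measurable_wOfRecord_of_localBg hU ϑ.τ9.M ϑ.A₁ hζm p g k s'
  have hsl := measurable_dressedSlotsOfDatum₉ F N ϑ D g₀ os p g hD hwm hχm t k
  refine Measure.ext fun E hE => ?_
  rw [cubeLawOfDatum₉_apply F N ϑ D g₀ os p g k t a hE, withDensity_apply _ hE]
  unfold cubeDensityOfDatum₉
  rw [lintegral_finsetSum _ fun s _ => ?_]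
  · refine Finset.sum_congr rfl fun s _ => ?_
    split_ifs
    · rfl
    · rw [lintegral_zero]
  · split_ifs
    · exact ((hχm k s).mul (hsl s)).ennreal_ofReal
    · exact measurable_const

/-- **THE BLOCK FIBRE LAW ON A MEASURABLE BLOCK EVENT** = the block integral of the pulled-back indicator × density (`withDensity_apply`, `lintegral_indicator`,
`Set.indicator_comp_right`) — definitionally the body of `MeasureTheory.lmarginal` at the base point `x`. [bookkeeping] -/
theorem blockFibreLawOfDatum₉_apply (t : ℝ) (a : ↥(cubeIndices (F.P p.K) (cubeSide (F.P p.K).L ϑ.ν.M₂ (RkOfRecord (F.P p.K).L ϑ.ν.r (g k)) k)))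
    (b : Finset (PBond (F.P p.K) k)) (x : GaugeField (F.P p.K) k (SU N)) {S : Set (GaugeField (F.P p.K) k (SU N))} (hS : MeasurableSet S) :
    letI := Classical.decEq (PBond (F.P p.K) k)
    blockFibreLawOfDatum₉ F N ϑ D g₀ os p g k t a b x {y | Function.updateFinset x b y ∈ S} =
      ∫⁻ y, S.indicator (cubeDensityOfDatum₉ F N ϑ D g₀ os p g k t a) (Function.updateFinset x b y)
        ∂(Measure.pi fun _ : ↥b => (HaarData.haar : Measure (SU N))) := by
  letI := Classical.decEq (PBond (F.P p.K) k)
  have hSy : MeasurableSet {y : ↥b → SU N | Function.updateFinset x b y ∈ S} := measurable_updateFinset hS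
  show ((Measure.pi fun _ : ↥b => (HaarData.haar : Measure (SU N))).withDensity
      (fun y => cubeDensityOfDatum₉ F N ϑ D g₀ os p g k t a (Function.updateFinset x b y))) {y | Function.updateFinset x b y ∈ S} = _
  rw [withDensity_apply _ hSy, ← lintegral_indicator hSy]
  exact lintegral_congr fun y =>
    Set.indicator_comp_right (fun y : ↥b → SU N => (Function.updateFinset x b y : GaugeField (F.P p.K) k (SU N)))
      (g := cubeDensityOfDatum₉ F N ϑ D g₀ os p g k t a)

/-- ★★★ **THE BLOCK DISINTEGRATION OF (M1)**: for ANY finite bond set `b`, ANY measurable statistic `u`, letters `θ, ρ` and a constant `D`: if AT EVERY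
exterior field `x` the block fibre law of the truncated law anti-concentrates the block reading of `u` —
`SlotAntiConcentration (blockFibreLawOfDatum₉ … t a b x) (blockReading u b x) θ ρ D` — then `SlotAntiConcentration (cubeLawOfDatum₉ … t a) u θ ρ D`, the hypothesis
of `…Law.cubeAC_of_slotAntiConcentration` ((H-U), (H-ζ), `D.AvgMeasurable` displayed for measurability). [bookkeeping] -/
theorem slotAntiConcentration_cubeLaw_of_blockFibres (hU : LocalBgMeasurable F N ϑ.ν) (hζm : ZetaMeasurable F N ϑ.ζ) (hD : D.AvgMeasurable) (t : ℝ)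
    (a : ↥(cubeIndices (F.P p.K) (cubeSide (F.P p.K).L ϑ.ν.M₂ (RkOfRecord (F.P p.K).L ϑ.ν.r (g k)) k))) (b : Finset (PBond (F.P p.K) k))
    {u : GaugeField (F.P p.K) k (SU N) → ℝ} (hu : Measurable u) {θ ρ Dc : ℝ}
    (hfib : ∀ x : GaugeField (F.P p.K) k (SU N),
      SlotAntiConcentration (blockFibreLawOfDatum₉ F N ϑ D g₀ os p g k t a b x) (blockReading N u b x) θ ρ Dc) :
    SlotAntiConcentration (cubeLawOfDatum₉ F N ϑ D g₀ os p g k t a) u θ ρ Dc := by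
  letI := Classical.decEq (PBond (F.P p.K) k)
  haveI : IsProbabilityMeasure (HaarData.haar : Measure (SU N)) := HaarData.isProb
  have hg := measurable_cubeDensityOfDatum₉ F N ϑ D g₀ os p g k hU hζm hD t a
  have hS : MeasurableSet {V : GaugeField (F.P p.K) k (SU N) | θ * (1 - ρ) ≤ u V ∧ u V < θ} := by
    rw [shell_eq_preimage]; exact hu measurableSet_Ico
  unfold SlotAntiConcentration
  rw [cubeLawOfDatum₉_eq_withDensity F N ϑ D g₀ os p g k hU hζm hD t a]
  -- the fibre at `x`: both block integrals are the block fibre law on the pulled-back events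
  have hfib' : ∀ x : GaugeField (F.P p.K) k (SU N),
      (∫⋯∫⁻_b, {V : GaugeField (F.P p.K) k (SU N) | θ * (1 - ρ) ≤ u V ∧ u V < θ}.indicator (cubeDensityOfDatum₉ F N ϑ D g₀ os p g k t a)
          ∂fun _ => (HaarData.haar : Measure (SU N))) x ≤
        ENNReal.ofReal (Dc * ρ) *
          (∫⋯∫⁻_b, (Set.univ : Set (GaugeField (F.P p.K) k (SU N))).indicator (cubeDensityOfDatum₉ F N ϑ D g₀ os p g k t a)
            ∂fun _ => (HaarData.haar : Measure (SU N))) x := by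
    intro x
    have h1 := blockFibreLawOfDatum₉_apply F N ϑ D g₀ os p g k t a b x hS
    have h2 := blockFibreLawOfDatum₉_apply F N ϑ D g₀ os p g k t a b x
      (MeasurableSet.univ : MeasurableSet (Set.univ : Set (GaugeField (F.P p.K) k (SU N))))
    have hev : {y : ↥b → SU N | Function.updateFinset x b y ∈ {V : GaugeField (F.P p.K) k (SU N) | θ * (1 - ρ) ≤ u V ∧ u V < θ}} =
        {y | θ * (1 - ρ) ≤ blockReading N u b x y ∧ blockReading N u b x y < θ} := by
      ext y; rfl
    have huniv : {y : ↥b → SU N | Function.updateFinset x b y ∈ (Set.univ : Set (GaugeField (F.P p.K) k (SU N)))} = Set.univ :=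
      Set.eq_univ_of_forall fun y => Set.mem_univ _
    calc (∫⋯∫⁻_b, {V : GaugeField (F.P p.K) k (SU N) | θ * (1 - ρ) ≤ u V ∧ u V < θ}.indicator (cubeDensityOfDatum₉ F N ϑ D g₀ os p g k t a)
            ∂fun _ => (HaarData.haar : Measure (SU N))) x
        = blockFibreLawOfDatum₉ F N ϑ D g₀ os p g k t a b x
            {y | Function.updateFinset x b y ∈ {V : GaugeField (F.P p.K) k (SU N) | θ * (1 - ρ) ≤ u V ∧ u V < θ}} := h1.symm
      _ = blockFibreLawOfDatum₉ F N ϑ D g₀ os p g k t a b x {y | θ * (1 - ρ) ≤ blockReading N u b x y ∧ blockReading N u b x y < θ} := by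
            rw [hev]
      _ ≤ ENNReal.ofReal (Dc * ρ) * blockFibreLawOfDatum₉ F N ϑ D g₀ os p g k t a b x Set.univ := hfib x
      _ = ENNReal.ofReal (Dc * ρ) *
            blockFibreLawOfDatum₉ F N ϑ D g₀ os p g k t a b x {y | Function.updateFinset x b y ∈ (Set.univ : Set (GaugeField (F.P p.K) k (SU N)))} := by
            rw [huniv]
      _ = ENNReal.ofReal (Dc * ρ) *
            (∫⋯∫⁻_b, (Set.univ : Set (GaugeField (F.P p.K) k (SU N))).indicator (cubeDensityOfDatum₉ F N ϑ D g₀ os p g k t a)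
              ∂fun _ => (HaarData.haar : Measure (SU N))) x := congrArg (fun z => ENNReal.ofReal (Dc * ρ) * z) h2
  exact withDensity_pi_apply_le_of_lmarginal (fun _ : PBond (F.P p.K) k => (HaarData.haar : Measure (SU N))) hg b hS MeasurableSet.univ
    (ENNReal.ofReal (Dc * ρ)) hfib'

end Fibre

/-! ## §3 Locality of the cube indicator: it reads the field only on the inputs of its (2.16) determining set, so on a block containing them the
fibre reading does not see the exterior -/

section Locality

open B14.Eq216Concrete (ukBox_congr inputs liftIter)
open B14.Eq213DetSet (Bj)
open B15DeterminingSets (AgreeOn)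
open B16Eq150VariableFields (isMinimizer_of_agreeOn agreeOn_symm)

variable (F : T4Family) (N : ℕ) [NeZero N] (ν : Stage7Numerics) (g : ℕ → ℝ) (Kc k : ℕ)

/-- ★ **LOCALITY OF THE CUBE INDICATOR OF RECORD**: the (2.12) solution map of record is a function of the (2.12) predicate (`UminOfRecord_congr_of_isMinimizer_iff₀`),
which reads its datum only on the determining set (`isMinimizer_of_agreeOn`, [III] (2.12) p. 256); so by r11's (2.16)-locality `ukBox_congr` the cube's indicator
`χ_a^{δ}(V)` depends on `V` only through its values on the bonds `liftIter k (inputs 𝐁_k(a^{∼4}))` feeding the determining set of `a^{∼4}` (`k ≤ m + Kc`).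
[bookkeeping] -/
theorem cubeChiAt_congr_of_agree_inputs (hk : k ≤ F.m + Kc) (δ : ℝ)
    (a : ↥(cubeIndices (F.P Kc) (cubeSide (F.P Kc).L ν.M₂ (RkOfRecord (F.P Kc).L ν.r (g k)) k))) {V W : GaugeField (F.P Kc) k (SU N)}
    (h : ∀ c ∈ liftIter k (inputs (Bj ν.M₁ (cubeEnl (F.P Kc) (cubeSide (F.P Kc).L ν.M₂ (RkOfRecord (F.P Kc).L ν.r (g k)) k) a 4) k)), V c = W c) :
    cubeChiAt F N ν g Kc k δ a V = cubeChiAt F N ν g Kc k δ a W := by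
  unfold cubeChiAt
  rw [ukBox_congr (bgOfRecord (avOfRecord F N Kc) {U | PlaqSmall (ν.εreg * (F.P Kc).eta k ^ 2) U}) ν.M₁ hk (fun X X' hXX' => ?_) h]
  exact UminOfRecord_congr_of_isMinimizer_iff₀ _ _ fun U₀ => ⟨isMinimizer_of_agreeOn hXX', isMinimizer_of_agreeOn (agreeOn_symm hXX')⟩

/-- ★★ **ON A BLOCK CONTAINING THE INPUTS THE FIBRE INDICATOR DOES NOT SEE THE EXTERIOR**: for a finite bond set `b ⊇ liftIter k (inputs 𝐁_k(a^{∼4}))`, the cube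
indicator at `updateFinset x b y` is the same for all exterior fields `x` — so in `slotAntiConcentration_cubeLaw_of_blockFibres` with that `b` the reading of any statistic
that is a function of the cube's (2.16) plaquette variables is ONE function of the block variables `y ∈ (SU N)^b`. [bookkeeping] -/
theorem cubeChiAt_updateFinset_eq (hk : k ≤ F.m + Kc) (δ : ℝ)
    (a : ↥(cubeIndices (F.P Kc) (cubeSide (F.P Kc).L ν.M₂ (RkOfRecord (F.P Kc).L ν.r (g k)) k))) (b : Finset (PBond (F.P Kc) k))
    (hb : liftIter k (inputs (Bj ν.M₁ (cubeEnl (F.P Kc) (cubeSide (F.P Kc).L ν.M₂ (RkOfRecord (F.P Kc).L ν.r (g k)) k) a 4) k)) ⊆ ↑b)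
    (x x' : GaugeField (F.P Kc) k (SU N)) (y : ↥b → SU N) :
    letI := Classical.decEq (PBond (F.P Kc) k)
    cubeChiAt F N ν g Kc k δ a (Function.updateFinset x b y) = cubeChiAt F N ν g Kc k δ a (Function.updateFinset x' b y) := by
  letI := Classical.decEq (PBond (F.P Kc) k)
  refine cubeChiAt_congr_of_agree_inputs F N ν g Kc k hk δ a fun c hc => ?_
  have hcb : c ∈ b := hb hc
  show Function.updateFinset x b y c = Function.updateFinset x' b y c
  rw [Function.updateFinset_def, Function.updateFinset_def]
  simp only [dif_pos hcb]

end Locality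

end Summit.QuantumFields.YangMills.Theorems.N21ShellSplitOfRecord13CoPH

end
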